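import Summits.ResolutionOfSingularities.ResolutionOfSingularities.Theorems.HilbertSamuelEliminationSigmaMaxModificationsCorridor3WLadderSegmentsHEmpStrong
import HarnessLib

/-!
# [OURS · L1 W4.2] (H-emp) WITHIN THE UNIT — STRONG-INDUCTION FORM WITH CURVE DATA (Dich⁺): the geometric inputs at a birth stage `n + 1` may use EVERYTHING the
# invariant knows at the stages `≤ n` (centres vs. near loci, dichotomy, regularity), so that the near-point geometry of ONE blow-up
# (CJS Lemma 6.33 / Def. 6.34, recognition geometry (R2)–(R4)) can be plugged in stage by stage
# (crux `SigmaMaxModifications` stmt-ResolutionOfSingularities-18506; conjunct `SigmaMaxModificationsCorridor3` stmt-…-19249; line `w_ladder`; RECOGNITION (R5))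

Stub worker res-L1-w42-stub-1 (gen 4). Helper file `--supports stmt-ResolutionOfSingularities-19249 --as helper`; kernel only, FACT-FREE, no new
definition. Strengthening of `…SegmentsHEmpBirths`: there (Dich)/(RegN) at a birth stage `n + 1` (after a genuine step `n`) were plain
hypotheses. The geometric analysis of the near points of the blow-up `X_{b+n+1} → X_{b+n}` over `N_n` needs to know that the centre IS the
near locus near `x_b` (`N_n ⊆ C_{b+n}`, hence `(locTower b).C n = ι_n⁻¹ N_n`, `…CentreNear.locTower_C_eq_preimage_nearLocus`) and the shape of
`N_m`, `m ≤ n` — facts the invariant itself produces. `Seg.invariant_strongPlus` (this file; `Seg.invariant_strong` is the form without curve data) runs the induction with the birth hypothesis in the form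
«given the invariant's data at all stages `m ≤ n`, produce (Dich)/(RegN) at `n + 1`», and delivers at every stage `n < M`: genuine ⇒
`N_n ⊆ C_{b+n}`, waiting ⇒ `C_{b+n} ∩ N_n = ∅`, (Dich_n), (RegN_n), and for `0 < n` one label + replay avoidance. Here (Dich) is carried in the STRONGER form (Dich⁺): the infinite branch also records «every non-generic point of `N_n` is
closed» (curve data, the input `hpts` of stub-2's lemma at the next birth); it propagates through waiting steps (`curveLike_succ_of_disjoint`:
the blow-down is an open embedding near `N_n`, so generic points correspond). Corollaries:
`Seg.dich_regN_of_birthsStrongPlus` (the inputs of every `M`-hypothesis theorem of `…SegmentsHEmp` / `…ExtractU` / `…CentreNear`) and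
`Seg.locTower_C_eq_empty_of_birthsStrongPlus` ((H-emp) within the unit).

OURS bookkeeping; NOT a statement of the manuscript [Hironaka2017] nor of [CossartJannsenSaito2020]. AI-written; AI review is weaker than expert
review.

References: V. Cossart, U. Jannsen, S. Saito, LNM 2270 (2020), Rem. 6.29 (1), Lemma 6.33, Def. 6.34, Def. 6.38, p. 105 [CossartJannsenSaito2020].
-/

noncomputable section

set_option linter.dupNamespace false -- namespace `…Corridor3.Moving` re-enters `…Corridor3` (module convention of the Moving files)

open CategoryTheory AlgebraicGeometry TopologicalSpace Topology IsLocalRing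
open Literature.AlgebraicGeometry.Resolution Literature.RingTheory.HilbertSamuel
open Literature.AlgebraicGeometry.CossartJannsenSaito2020
open Summit.ResolutionOfSingularities.ResolutionOfSingularities.Theorems.CampaignW42
open Summit.ResolutionOfSingularities.ResolutionOfSingularities.Theorems.SigmaMaxModificationsCorridor3.Helpers

namespace Summit.ResolutionOfSingularities.ResolutionOfSingularities.Theorems.SigmaMaxModificationsCorridor3.Moving.Seg

variable {R : ∀ S : Scheme.{0}, CentreSeq S → Prop} {N : ℕ} {ν : ℕ → ℕ} {k : Type} [Field k]
  {c : ℕ → MarkedStage.{0}} (hc : ∀ n, CanonicalNearStep R N ν (c n) (c (n + 1))) (hRf : OracleFunctional R) (hRa : OracleAdmissible R)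
  (hν : ν ≠ iterPSum N Phi) (h0 : Helpers.CycleInv k N ν (c 0))
  {p : ℕ} {X : Scheme.{0}} [IsLocallyNoetherian X] {x : X} (hX : IsMaximalOrigin p N ν X x)
  (hreach : Reaches R N ν (MarkedStage.init X x) (c 0))

include hX hreach in
/-- **CURVE DATA PROPAGATES THROUGH A STEP WHOSE CENTRE MISSES THE NEAR LOCUS**: if every non-generic point of the irreducible `N_n` is closed,
the same holds for `N_{n+1} = π⁻¹(N_n)` (the blow-down is an open embedding over the complement of the centre, so it matches generic points).
[cite: GortzWedhorn2020, Prop. 13.91 (3)] -/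
theorem curveLike_succ_of_disjoint (b n : ℕ)
    (hdisj : (upTower hc hRa hν h0 b).C n ∩ (upTower hc hRa hν h0 b).nearLocus N (c b).pt n = ∅)
    (hpts : ∀ y ∈ (upTower hc hRa hν h0 b).nearLocus N (c b).pt n, ¬ IsGenericPoint y ((upTower hc hRa hν h0 b).nearLocus N (c b).pt n) →
      IsClosed ({y} : Set (c (b + n)).W)) :
    ∀ z ∈ (upTower hc hRa hν h0 b).nearLocus N (c b).pt (n + 1), ¬ IsGenericPoint z ((upTower hc hRa hν h0 b).nearLocus N (c b).pt (n + 1)) →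
      IsClosed ({z} : Set (c (b + (n + 1))).W) := by
  have heq := nearLocus_succ_eq_preimage hc hRa hν h0 b n hdisj
  have hout : ∀ y ∈ (upTower hc hRa hν h0 b).nearLocus N (c b).pt n, y ∉ (upTower hc hRa hν h0 b).C n := fun y hy h => by
    have : y ∈ (upTower hc hRa hν h0 b).C n ∩ (upTower hc hRa hν h0 b).nearLocus N (c b).pt n := ⟨h, hy⟩
    rw [hdisj] at this; exact this
  intro z hz hng
  have hz' : ((upTower hc hRa hν h0 b).π n).base z ∈ (upTower hc hRa hν h0 b).nearLocus N (c b).pt n := by rw [heq] at hz; exact hz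
  -- `π z` is not a generic point of `N_n`: otherwise `z` would be one of `N_{n+1}`
  have hng' : ¬ IsGenericPoint (((upTower hc hRa hν h0 b).π n).base z) ((upTower hc hRa hν h0 b).nearLocus N (c b).pt n) := by
    intro hgen
    apply hng
    rw [isGenericPoint_iff_specializes]
    intro w
    constructor
    · intro hzw
      exact hzw.mem_closed (isClosed_nearLocus hc hRa hν h0 hX hreach b (n + 1)) hz
    · intro hw
      have hw' : ((upTower hc hRa hν h0 b).π n).base w ∈ (upTower hc hRa hν h0 b).nearLocus N (c b).pt n := by rw [heq] at hw; exact hw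
      -- specialization downstairs, reflected along the open embedding `(π⁻¹ U).ι ≫ π`
      have hsp : ((upTower hc hRa hν h0 b).π n).base z ⤳ ((upTower hc hRa hν h0 b).π n).base w := hgen.specializes hw'
      let J := Scheme.IdealSheafData.vanishingIdeal (⟨(upTower hc hRa hν h0 b).C n, (upTower hc hRa hν h0 b).isClosed_C n⟩ :
        Closeds ((upTower hc hRa hν h0 b).X n))
      have hzU : z ∈ (upTower hc hRa hν h0 b).π n ⁻¹ᵁ centreCompl J := by
        show ((upTower hc hRa hν h0 b).π n).base z ∈ ((J.support : Set ((upTower hc hRa hν h0 b).X n)))ᶜ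
        rw [Scheme.IdealSheafData.coe_support_vanishingIdeal]; exact hout _ hz'
      have hwU : w ∈ (upTower hc hRa hν h0 b).π n ⁻¹ᵁ centreCompl J := by
        show ((upTower hc hRa hν h0 b).π n).base w ∈ ((J.support : Set ((upTower hc hRa hν h0 b).X n)))ᶜ
        rw [Scheme.IdealSheafData.coe_support_vanishingIdeal]; exact hout _ hw'
      haveI hoi : IsOpenImmersion (((upTower hc hRa hν h0 b).π n ⁻¹ᵁ centreCompl J).ι ≫ (upTower hc hRa hν h0 b).π n) :=
        ((upTower hc hRa hν h0 b).isBlowup n).isOpenImmersion_preimage_compl_ι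
      have h1 : (((upTower hc hRa hν h0 b).π n ⁻¹ᵁ centreCompl J).ι ≫ (upTower hc hRa hν h0 b).π n).base ⟨z, hzU⟩ ⤳
          (((upTower hc hRa hν h0 b).π n ⁻¹ᵁ centreCompl J).ι ≫ (upTower hc hRa hν h0 b).π n).base ⟨w, hwU⟩ := by
        rw [Scheme.Hom.comp_apply, Scheme.Hom.comp_apply]; exact hsp
      have h2 : (⟨z, hzU⟩ : ↥((upTower hc hRa hν h0 b).π n ⁻¹ᵁ centreCompl J)) ⤳ ⟨w, hwU⟩ :=
        (hoi.base_open.isEmbedding.isInducing.specializes_iff).mp h1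
      exact h2.map ((upTower hc hRa hν h0 b).π n ⁻¹ᵁ centreCompl J).ι.continuous
  have hcl := hpts _ hz' hng'
  obtain ⟨w, -, huniq⟩ := exists_unique_preimage_of_not_mem_C (upTower hc hRa hν h0 b) n (hout _ hz')
  have hpre : (((upTower hc hRa hν h0 b).π n).base ⁻¹' ({((upTower hc hRa hν h0 b).π n).base z} : Set (c (b + n)).W) : Set (c (b + (n + 1))).W) =
      ({z} : Set (c (b + (n + 1))).W) :=
    Set.eq_singleton_iff_unique_mem.mpr ⟨rfl, fun z' h => (huniq z' h).trans (huniq z rfl).symm⟩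
  have hclz : IsClosed (((upTower hc hRa hν h0 b).π n).base ⁻¹' ({((upTower hc hRa hν h0 b).π n).base z} : Set (c (b + n)).W) :
      Set (c (b + (n + 1))).W) := hcl.preimage ((upTower hc hRa hν h0 b).π n).continuous
  rw [hpre] at hclz
  exact hclz

include hRf hX hreach in
/-- **THE INVARIANT OF THE UNIT, STRONG-INDUCTION FORM.** Base `b` blown up at a marked point isolated in the Hilbert–Samuel locus; `M` a bound.
BIRTH HYPOTHESIS: at every genuine step `n` with `n + 1 < M`, GIVEN at all stages `m ≤ n` the data «genuine ⇒ `N_m ⊆ C_{b+m}`», «waiting ⇒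
`C_{b+m} ∩ N_m = ∅`», (Dich_m), (RegN_m), produce (Dich_{n+1}) and (RegN_{n+1}). CONCLUSION: that data at every `n < M`, and one label +
replay avoidance at every `0 < n < M`. [cite: CossartJannsenSaito2020, Rem. 6.29 (1), Lemma 6.33, Def. 6.34, Def. 6.38] -/
theorem invariant_strongPlus (b : ℕ) (hb : (c b).IsBlownUp R N ν) (hiso : Iso N (c b)) (M : ℕ)
    (hBirth : ∀ n, n + 1 < M → (c (b + n)).IsBlownUp R N ν →
      (∀ m, m ≤ n →
        ((c (b + m)).IsBlownUp R N ν → (upTower hc hRa hν h0 b).nearLocus N (c b).pt m ⊆ (upTower hc hRa hν h0 b).C m) ∧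
        (¬ (c (b + m)).IsBlownUp R N ν → (upTower hc hRa hν h0 b).C m ∩ (upTower hc hRa hν h0 b).nearLocus N (c b).pt m = ∅) ∧
        ((((upTower hc hRa hν h0 b).nearLocus N (c b).pt m).Infinite ∧ IsIrreducible ((upTower hc hRa hν h0 b).nearLocus N (c b).pt m) ∧
          ∀ y ∈ (upTower hc hRa hν h0 b).nearLocus N (c b).pt m, ¬ IsGenericPoint y ((upTower hc hRa hν h0 b).nearLocus N (c b).pt m) →
            IsClosed ({y} : Set (c (b + m)).W)) ∨
          (((upTower hc hRa hν h0 b).nearLocus N (c b).pt m).Finite ∧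
            ∀ y ∈ (upTower hc hRa hν h0 b).nearLocus N (c b).pt m, IsClosed ({y} : Set (c (b + m)).W))) ∧
        (((upTower hc hRa hν h0 b).nearLocus N (c b).pt m).Infinite →
          ∀ h : IsClosed ((upTower hc hRa hν h0 b).nearLocus N (c b).pt m),
            Scheme.IsRegular (Scheme.IdealSheafData.vanishingIdeal ⟨(upTower hc hRa hν h0 b).nearLocus N (c b).pt m, h⟩).subscheme)) →
      ((((upTower hc hRa hν h0 b).nearLocus N (c b).pt (n + 1)).Infinite ∧ IsIrreducible ((upTower hc hRa hν h0 b).nearLocus N (c b).pt (n + 1)) ∧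
          ∀ y ∈ (upTower hc hRa hν h0 b).nearLocus N (c b).pt (n + 1), ¬ IsGenericPoint y ((upTower hc hRa hν h0 b).nearLocus N (c b).pt (n + 1)) →
            IsClosed ({y} : Set (c (b + (n + 1))).W)) ∨
        (((upTower hc hRa hν h0 b).nearLocus N (c b).pt (n + 1)).Finite ∧
          ∀ y ∈ (upTower hc hRa hν h0 b).nearLocus N (c b).pt (n + 1), IsClosed ({y} : Set (c (b + (n + 1))).W))) ∧
      (((upTower hc hRa hν h0 b).nearLocus N (c b).pt (n + 1)).Infinite →
        ∀ h : IsClosed ((upTower hc hRa hν h0 b).nearLocus N (c b).pt (n + 1)),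
          Scheme.IsRegular (Scheme.IdealSheafData.vanishingIdeal ⟨(upTower hc hRa hν h0 b).nearLocus N (c b).pt (n + 1), h⟩).subscheme)) :
    ∀ n, n < M →
      (((c (b + n)).IsBlownUp R N ν → (upTower hc hRa hν h0 b).nearLocus N (c b).pt n ⊆ (upTower hc hRa hν h0 b).C n) ∧
        (¬ (c (b + n)).IsBlownUp R N ν → (upTower hc hRa hν h0 b).C n ∩ (upTower hc hRa hν h0 b).nearLocus N (c b).pt n = ∅) ∧
        ((((upTower hc hRa hν h0 b).nearLocus N (c b).pt n).Infinite ∧ IsIrreducible ((upTower hc hRa hν h0 b).nearLocus N (c b).pt n) ∧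
          ∀ y ∈ (upTower hc hRa hν h0 b).nearLocus N (c b).pt n, ¬ IsGenericPoint y ((upTower hc hRa hν h0 b).nearLocus N (c b).pt n) →
            IsClosed ({y} : Set (c (b + n)).W)) ∨
          (((upTower hc hRa hν h0 b).nearLocus N (c b).pt n).Finite ∧
            ∀ y ∈ (upTower hc hRa hν h0 b).nearLocus N (c b).pt n, IsClosed ({y} : Set (c (b + n)).W))) ∧
        (((upTower hc hRa hν h0 b).nearLocus N (c b).pt n).Infinite →
          ∀ h : IsClosed ((upTower hc hRa hν h0 b).nearLocus N (c b).pt n),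
            Scheme.IsRegular (Scheme.IdealSheafData.vanishingIdeal ⟨(upTower hc hRa hν h0 b).nearLocus N (c b).pt n, h⟩).subscheme)) ∧
      (0 < n →
        (∀ Z₁ ∈ componentsIn (Scheme.hsStratum (c (b + n)).W N ν), ∀ Z₂ ∈ componentsIn (Scheme.hsStratum (c (b + n)).W N ν),
          Z₁ ⊆ (upTower hc hRa hν h0 b).nearLocus N (c b).pt n → Z₂ ⊆ (upTower hc hRa hν h0 b).nearLocus N (c b).pt n →
            (c (b + n)).L.label Z₁ = (c (b + n)).L.label Z₂) ∧
        ∀ Q, (c (b + n)).P = some Q → Q.rest.CentresOver (Q.hom.base ⁻¹' ((upTower hc hRa hν h0 b).nearLocus N (c b).pt n)ᶜ)) := by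
  obtain ⟨k', _, _, hg⟩ := hX.exists_stateGood_of_reaches hRa hν (reaches_chain hreach hc b)
  have hU := stratumIsolated_of_iso hg hiso
  obtain ⟨hN0, hD0, hone0⟩ := nearLocus_base hc hRa hν h0 hX hreach b
  have hDC0 : (((upTower hc hRa hν h0 b).nearLocus N (c b).pt 0).Infinite ∧ IsIrreducible ((upTower hc hRa hν h0 b).nearLocus N (c b).pt 0) ∧
          ∀ y ∈ (upTower hc hRa hν h0 b).nearLocus N (c b).pt 0, ¬ IsGenericPoint y ((upTower hc hRa hν h0 b).nearLocus N (c b).pt 0) →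
            IsClosed ({y} : Set (c (b + 0)).W)) ∨
      (((upTower hc hRa hν h0 b).nearLocus N (c b).pt 0).Finite ∧
        ∀ y ∈ (upTower hc hRa hν h0 b).nearLocus N (c b).pt 0, IsClosed ({y} : Set (c (b + 0)).W)) := by
    rcases hD0 with ⟨hinf, -⟩ | h
    · exfalso; apply hinf; rw [hN0]; exact Set.finite_singleton _
    · exact Or.inr h
  -- stage 0 data
  have hR0 : ((upTower hc hRa hν h0 b).nearLocus N (c b).pt 0).Infinite →
      ∀ h : IsClosed ((upTower hc hRa hν h0 b).nearLocus N (c b).pt 0),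
        Scheme.IsRegular (Scheme.IdealSheafData.vanishingIdeal ⟨(upTower hc hRa hν h0 b).nearLocus N (c b).pt 0, h⟩).subscheme := by
    intro hinf; exfalso; apply hinf; rw [hN0]; exact Set.finite_singleton _
  have hCN0 : ((c (b + 0)).IsBlownUp R N ν → (upTower hc hRa hν h0 b).nearLocus N (c b).pt 0 ⊆ (upTower hc hRa hν h0 b).C 0) ∧
      (¬ (c (b + 0)).IsBlownUp R N ν → (upTower hc hRa hν h0 b).C 0 ∩ (upTower hc hRa hν h0 b).nearLocus N (c b).pt 0 = ∅) := by
    refine ⟨fun hg => ?_, fun hw => absurd hb hw⟩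
    obtain ⟨P', hcs⟩ := Helpers.isCanonicalStep_chainCentre (shiftStep hc b) 0
    obtain ⟨C₁, P₁, hcs₁, hx₁⟩ := hg
    obtain rfl : C₁ = Helpers.chainCentre (shiftStep hc b) 0 := hcs₁.centre_unique hRf hcs
    rw [hN0]; exact Set.singleton_subset_iff.mpr hx₁
  -- strong induction: all stages `m ≤ n` at once
  suffices H : ∀ n, ∀ m, m ≤ n → m < M →
      (((c (b + m)).IsBlownUp R N ν → (upTower hc hRa hν h0 b).nearLocus N (c b).pt m ⊆ (upTower hc hRa hν h0 b).C m) ∧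
        (¬ (c (b + m)).IsBlownUp R N ν → (upTower hc hRa hν h0 b).C m ∩ (upTower hc hRa hν h0 b).nearLocus N (c b).pt m = ∅) ∧
        ((((upTower hc hRa hν h0 b).nearLocus N (c b).pt m).Infinite ∧ IsIrreducible ((upTower hc hRa hν h0 b).nearLocus N (c b).pt m) ∧
          ∀ y ∈ (upTower hc hRa hν h0 b).nearLocus N (c b).pt m, ¬ IsGenericPoint y ((upTower hc hRa hν h0 b).nearLocus N (c b).pt m) →
            IsClosed ({y} : Set (c (b + m)).W)) ∨
          (((upTower hc hRa hν h0 b).nearLocus N (c b).pt m).Finite ∧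
            ∀ y ∈ (upTower hc hRa hν h0 b).nearLocus N (c b).pt m, IsClosed ({y} : Set (c (b + m)).W))) ∧
        (((upTower hc hRa hν h0 b).nearLocus N (c b).pt m).Infinite →
          ∀ h : IsClosed ((upTower hc hRa hν h0 b).nearLocus N (c b).pt m),
            Scheme.IsRegular (Scheme.IdealSheafData.vanishingIdeal ⟨(upTower hc hRa hν h0 b).nearLocus N (c b).pt m, h⟩).subscheme)) ∧
      (0 < m →
        (∀ Z₁ ∈ componentsIn (Scheme.hsStratum (c (b + m)).W N ν), ∀ Z₂ ∈ componentsIn (Scheme.hsStratum (c (b + m)).W N ν),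
          Z₁ ⊆ (upTower hc hRa hν h0 b).nearLocus N (c b).pt m → Z₂ ⊆ (upTower hc hRa hν h0 b).nearLocus N (c b).pt m →
            (c (b + m)).L.label Z₁ = (c (b + m)).L.label Z₂) ∧
        ∀ Q, (c (b + m)).P = some Q → Q.rest.CentresOver (Q.hom.base ⁻¹' ((upTower hc hRa hν h0 b).nearLocus N (c b).pt m)ᶜ)) from
    fun n hn => H n n le_rfl hn
  intro n
  induction n with
  | zero =>
    intro m hm _
    obtain rfl : m = 0 := Nat.le_zero.mp hm
    exact ⟨⟨hCN0.1, hCN0.2, hDC0, hR0⟩, fun h => absurd h (lt_irrefl 0)⟩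
  | succ n ih =>
    intro m hm hmM
    rcases Nat.lt_or_ge m (n + 1) with hlt | hge
    · exact ih m (Nat.lt_succ_iff.mp hlt) hmM
    obtain rfl : m = n + 1 := le_antisymm hm hge
    have hnM : n < M := Nat.lt_of_succ_lt hmM
    have ihn := ih n le_rfl hnM
    obtain ⟨⟨hCNn, hCNn', hDn, hRn⟩, hposn⟩ := ihn
    -- (Dich)/(RegN) at `n + 1`
    have hnext : ((((upTower hc hRa hν h0 b).nearLocus N (c b).pt (n + 1)).Infinite ∧ IsIrreducible ((upTower hc hRa hν h0 b).nearLocus N (c b).pt (n + 1)) ∧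
          ∀ y ∈ (upTower hc hRa hν h0 b).nearLocus N (c b).pt (n + 1), ¬ IsGenericPoint y ((upTower hc hRa hν h0 b).nearLocus N (c b).pt (n + 1)) →
            IsClosed ({y} : Set (c (b + (n + 1))).W)) ∨
        (((upTower hc hRa hν h0 b).nearLocus N (c b).pt (n + 1)).Finite ∧
          ∀ y ∈ (upTower hc hRa hν h0 b).nearLocus N (c b).pt (n + 1), IsClosed ({y} : Set (c (b + (n + 1))).W))) ∧
        (((upTower hc hRa hν h0 b).nearLocus N (c b).pt (n + 1)).Infinite →
          ∀ h : IsClosed ((upTower hc hRa hν h0 b).nearLocus N (c b).pt (n + 1)),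
            Scheme.IsRegular (Scheme.IdealSheafData.vanishingIdeal ⟨(upTower hc hRa hν h0 b).nearLocus N (c b).pt (n + 1), h⟩).subscheme) := by
      by_cases hBn : (c (b + n)).IsBlownUp R N ν
      · exact hBirth n hmM hBn fun m hm => (ih m hm (lt_of_le_of_lt hm hnM)).1
      · have hdisj := hCNn' hBn
        have hweak := dich_succ_of_disjoint hc hRa hν h0 hX hreach b n hdisj (hDn.imp (fun h => ⟨h.1, h.2.1⟩) id)
        refine ⟨?_, fun hinf h' => ?_⟩
        · rcases hDn with ⟨hinfn, hirrn, hptsn⟩ | hfin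
          · have hinf1 : ((upTower hc hRa hν h0 b).nearLocus N (c b).pt (n + 1)).Infinite := by
              rw [nearLocus_succ_eq_preimage hc hRa hν h0 b n hdisj]
              refine hinfn.preimage fun y hy => ?_
              have hout : y ∉ (upTower hc hRa hν h0 b).C n := fun hC => by
                have : y ∈ (upTower hc hRa hν h0 b).C n ∩ (upTower hc hRa hν h0 b).nearLocus N (c b).pt n := ⟨hC, hy⟩
                rw [hdisj] at this; exact this
              obtain ⟨z, hz, -⟩ := exists_unique_preimage_of_not_mem_C (upTower hc hRa hν h0 b) n hout
              exact ⟨z, hz⟩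
            rcases hweak with ⟨_, hirr1⟩ | ⟨hfin1, -⟩
            · exact Or.inl ⟨hinf1, hirr1, curveLike_succ_of_disjoint hc hRa hν h0 hX hreach b n hdisj hptsn⟩
            · exact absurd hfin1 hinf1
          · rcases hweak with ⟨hinf1, -⟩ | hfin1
            · exfalso
              rw [nearLocus_succ_eq_preimage hc hRa hν h0 b n hdisj] at hinf1
              refine hinf1 (hfin.1.preimage fun z₁ _ z₂ hz₂ h => ?_)
              have hout : ((upTower hc hRa hν h0 b).π n).base z₂ ∉ (upTower hc hRa hν h0 b).C n := fun hC => by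
                have : _ ∈ (upTower hc hRa hν h0 b).C n ∩ (upTower hc hRa hν h0 b).nearLocus N (c b).pt n := ⟨hC, hz₂⟩
                rw [hdisj] at this; exact this
              obtain ⟨z, -, huniq⟩ := exists_unique_preimage_of_not_mem_C (upTower hc hRa hν h0 b) n hout
              exact (huniq z₁ h).trans (huniq z₂ rfl).symm
            · exact Or.inr hfin1
        have hinfn : ((upTower hc hRa hν h0 b).nearLocus N (c b).pt n).Infinite := by
          intro hfin
          rw [nearLocus_succ_eq_preimage hc hRa hν h0 b n hdisj] at hinf
          refine hinf (hfin.preimage fun z₁ _ z₂ hz₂ h => ?_)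
          have hout : ((upTower hc hRa hν h0 b).π n).base z₂ ∉ (upTower hc hRa hν h0 b).C n := fun hC => by
            have : _ ∈ (upTower hc hRa hν h0 b).C n ∩ (upTower hc hRa hν h0 b).nearLocus N (c b).pt n := ⟨hC, hz₂⟩
            rw [hdisj] at this; exact this
          obtain ⟨z, -, huniq⟩ := exists_unique_preimage_of_not_mem_C (upTower hc hRa hν h0 b) n hout
          exact (huniq z₁ h).trans (huniq z₂ rfl).symm
        exact regN_succ_of_disjoint hc hRa hν h0 hX hreach b n hdisj (hRn hinfn) h'
    -- one label and replay avoidance at `n + 1`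
    have hlab : (∀ Z₁ ∈ componentsIn (Scheme.hsStratum (c (b + (n + 1))).W N ν), ∀ Z₂ ∈ componentsIn (Scheme.hsStratum (c (b + (n + 1))).W N ν),
          Z₁ ⊆ (upTower hc hRa hν h0 b).nearLocus N (c b).pt (n + 1) → Z₂ ⊆ (upTower hc hRa hν h0 b).nearLocus N (c b).pt (n + 1) →
            (c (b + (n + 1))).L.label Z₁ = (c (b + (n + 1))).L.label Z₂) ∧
        ∀ Q, (c (b + (n + 1))).P = some Q → Q.rest.CentresOver (Q.hom.base ⁻¹' ((upTower hc hRa hν h0 b).nearLocus N (c b).pt (n + 1))ᶜ) := by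
      rcases Nat.eq_zero_or_pos n with rfl | hpos
      · refine ⟨oneLabel_succ hc hRa hν h0 hX hreach b hU 0 hD0 (hnext.1.imp (fun h => ⟨h.1, h.2.1⟩) id) hone0, fun Q hQ => ?_⟩
        have hnone : (c (b + 1)).P = none := P_succ_eq_none_of_isBlownUp_of_iso hc hRf hRa hν hX hreach b hb hiso
        exact absurd (hnone.symm.trans hQ) (by simp)
      · obtain ⟨hone, hRA⟩ := hposn hpos
        refine ⟨oneLabel_succ hc hRa hν h0 hX hreach b hU n (hDn.imp (fun h => ⟨h.1, h.2.1⟩) id) (hnext.1.imp (fun h => ⟨h.1, h.2.1⟩) id) hone, ?_⟩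
        have hf : StepProjection R N ν (c (b + n)) (c (b + (n + 1))) ((upTower hc hRa hν h0 b).π n) :=
          Helpers.stepProjection_chainProj (shiftStep hc b) n
        exact replayAvoid_step hRa hf (image_nearLocus_succ_subset hc hRa hν h0 b n) hRA
          fun _ j h _ z hz => part_regular_along_nearLocus hc hRa hν h0 hX hreach b hU n hone (hDn.imp (fun h => ⟨h.1, h.2.1⟩) id) hRn j h z hz
    have hCN := centre_vs_nearLocus_of_stage hc hRf hRa hν h0 hX hreach b hU (n + 1) hlab.1 hlab.2 (hnext.1.imp (fun h => ⟨h.1, h.2.1⟩) id) hnext.2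
    exact ⟨⟨hCN.1, hCN.2, hnext.1, hnext.2⟩, fun _ => hlab⟩

include hRf hX hreach in
/-- **(Dich)/(RegN) at all stages `0 < n < M` from the strong birth hypothesis** — feeds `Seg.locTower_C_eq_empty_of_lt`, `Seg.hEmpU_of_nearLocus_geometry`,
`Seg.unitTowerU_C_eq_nearLocus`, `Seg.unitCentreDiscipline_of_geometry`. [cite: CossartJannsenSaito2020, Lemma 6.33, Def. 6.34] -/
theorem dich_regN_of_birthsStrongPlus (b : ℕ) (hb : (c b).IsBlownUp R N ν) (hiso : Iso N (c b)) (M : ℕ)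
    (hBirth : ∀ n, n + 1 < M → (c (b + n)).IsBlownUp R N ν →
      (∀ m, m ≤ n →
        ((c (b + m)).IsBlownUp R N ν → (upTower hc hRa hν h0 b).nearLocus N (c b).pt m ⊆ (upTower hc hRa hν h0 b).C m) ∧
        (¬ (c (b + m)).IsBlownUp R N ν → (upTower hc hRa hν h0 b).C m ∩ (upTower hc hRa hν h0 b).nearLocus N (c b).pt m = ∅) ∧
        ((((upTower hc hRa hν h0 b).nearLocus N (c b).pt m).Infinite ∧ IsIrreducible ((upTower hc hRa hν h0 b).nearLocus N (c b).pt m) ∧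
          ∀ y ∈ (upTower hc hRa hν h0 b).nearLocus N (c b).pt m, ¬ IsGenericPoint y ((upTower hc hRa hν h0 b).nearLocus N (c b).pt m) →
            IsClosed ({y} : Set (c (b + m)).W)) ∨
          (((upTower hc hRa hν h0 b).nearLocus N (c b).pt m).Finite ∧
            ∀ y ∈ (upTower hc hRa hν h0 b).nearLocus N (c b).pt m, IsClosed ({y} : Set (c (b + m)).W))) ∧
        (((upTower hc hRa hν h0 b).nearLocus N (c b).pt m).Infinite →
          ∀ h : IsClosed ((upTower hc hRa hν h0 b).nearLocus N (c b).pt m),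
            Scheme.IsRegular (Scheme.IdealSheafData.vanishingIdeal ⟨(upTower hc hRa hν h0 b).nearLocus N (c b).pt m, h⟩).subscheme)) →
      ((((upTower hc hRa hν h0 b).nearLocus N (c b).pt (n + 1)).Infinite ∧ IsIrreducible ((upTower hc hRa hν h0 b).nearLocus N (c b).pt (n + 1)) ∧
          ∀ y ∈ (upTower hc hRa hν h0 b).nearLocus N (c b).pt (n + 1), ¬ IsGenericPoint y ((upTower hc hRa hν h0 b).nearLocus N (c b).pt (n + 1)) →
            IsClosed ({y} : Set (c (b + (n + 1))).W)) ∨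
        (((upTower hc hRa hν h0 b).nearLocus N (c b).pt (n + 1)).Finite ∧
          ∀ y ∈ (upTower hc hRa hν h0 b).nearLocus N (c b).pt (n + 1), IsClosed ({y} : Set (c (b + (n + 1))).W))) ∧
      (((upTower hc hRa hν h0 b).nearLocus N (c b).pt (n + 1)).Infinite →
        ∀ h : IsClosed ((upTower hc hRa hν h0 b).nearLocus N (c b).pt (n + 1)),
          Scheme.IsRegular (Scheme.IdealSheafData.vanishingIdeal ⟨(upTower hc hRa hν h0 b).nearLocus N (c b).pt (n + 1), h⟩).subscheme)) :
    (∀ n, 0 < n → n < M →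
      (((upTower hc hRa hν h0 b).nearLocus N (c b).pt n).Infinite ∧ IsIrreducible ((upTower hc hRa hν h0 b).nearLocus N (c b).pt n) ∧
          ∀ y ∈ (upTower hc hRa hν h0 b).nearLocus N (c b).pt n, ¬ IsGenericPoint y ((upTower hc hRa hν h0 b).nearLocus N (c b).pt n) →
            IsClosed ({y} : Set (c (b + n)).W)) ∨
      (((upTower hc hRa hν h0 b).nearLocus N (c b).pt n).Finite ∧
        ∀ y ∈ (upTower hc hRa hν h0 b).nearLocus N (c b).pt n, IsClosed ({y} : Set (c (b + n)).W))) ∧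
    (∀ n, 0 < n → n < M → ((upTower hc hRa hν h0 b).nearLocus N (c b).pt n).Infinite →
      ∀ h : IsClosed ((upTower hc hRa hν h0 b).nearLocus N (c b).pt n),
        Scheme.IsRegular (Scheme.IdealSheafData.vanishingIdeal ⟨(upTower hc hRa hν h0 b).nearLocus N (c b).pt n, h⟩).subscheme) :=
  ⟨fun n _ hM => (invariant_strongPlus hc hRf hRa hν h0 hX hreach b hb hiso M hBirth n hM).1.2.2.1,
    fun n _ hM => (invariant_strongPlus hc hRf hRa hν h0 hX hreach b hb hiso M hBirth n hM).1.2.2.2⟩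

include hRf hX hreach in
/-- **(H-emp) WITHIN THE UNIT FROM THE STRONG BIRTH HYPOTHESIS.** [cite: CossartJannsenSaito2020, Def. 6.38 (iii), Rem. 6.29 (1)] -/
theorem locTower_C_eq_empty_of_birthsStrongPlus (b : ℕ) (hb : (c b).IsBlownUp R N ν) (hiso : Iso N (c b)) (M : ℕ)
    (hBirth : ∀ n, n + 1 < M → (c (b + n)).IsBlownUp R N ν →
      (∀ m, m ≤ n →
        ((c (b + m)).IsBlownUp R N ν → (upTower hc hRa hν h0 b).nearLocus N (c b).pt m ⊆ (upTower hc hRa hν h0 b).C m) ∧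
        (¬ (c (b + m)).IsBlownUp R N ν → (upTower hc hRa hν h0 b).C m ∩ (upTower hc hRa hν h0 b).nearLocus N (c b).pt m = ∅) ∧
        ((((upTower hc hRa hν h0 b).nearLocus N (c b).pt m).Infinite ∧ IsIrreducible ((upTower hc hRa hν h0 b).nearLocus N (c b).pt m) ∧
          ∀ y ∈ (upTower hc hRa hν h0 b).nearLocus N (c b).pt m, ¬ IsGenericPoint y ((upTower hc hRa hν h0 b).nearLocus N (c b).pt m) →
            IsClosed ({y} : Set (c (b + m)).W)) ∨
          (((upTower hc hRa hν h0 b).nearLocus N (c b).pt m).Finite ∧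
            ∀ y ∈ (upTower hc hRa hν h0 b).nearLocus N (c b).pt m, IsClosed ({y} : Set (c (b + m)).W))) ∧
        (((upTower hc hRa hν h0 b).nearLocus N (c b).pt m).Infinite →
          ∀ h : IsClosed ((upTower hc hRa hν h0 b).nearLocus N (c b).pt m),
            Scheme.IsRegular (Scheme.IdealSheafData.vanishingIdeal ⟨(upTower hc hRa hν h0 b).nearLocus N (c b).pt m, h⟩).subscheme)) →
      ((((upTower hc hRa hν h0 b).nearLocus N (c b).pt (n + 1)).Infinite ∧ IsIrreducible ((upTower hc hRa hν h0 b).nearLocus N (c b).pt (n + 1)) ∧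
          ∀ y ∈ (upTower hc hRa hν h0 b).nearLocus N (c b).pt (n + 1), ¬ IsGenericPoint y ((upTower hc hRa hν h0 b).nearLocus N (c b).pt (n + 1)) →
            IsClosed ({y} : Set (c (b + (n + 1))).W)) ∨
        (((upTower hc hRa hν h0 b).nearLocus N (c b).pt (n + 1)).Finite ∧
          ∀ y ∈ (upTower hc hRa hν h0 b).nearLocus N (c b).pt (n + 1), IsClosed ({y} : Set (c (b + (n + 1))).W))) ∧
      (((upTower hc hRa hν h0 b).nearLocus N (c b).pt (n + 1)).Infinite →
        ∀ h : IsClosed ((upTower hc hRa hν h0 b).nearLocus N (c b).pt (n + 1)),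
          Scheme.IsRegular (Scheme.IdealSheafData.vanishingIdeal ⟨(upTower hc hRa hν h0 b).nearLocus N (c b).pt (n + 1), h⟩).subscheme))
    (n : ℕ) (hn : n < M) (hw : ¬ (c (b + n)).IsBlownUp R N ν) : (locTower hc hRa hν h0 b).C n = ∅ := by
  obtain ⟨k', _, _, hg⟩ := hX.exists_stateGood_of_reaches hRa hν (reaches_chain hreach hc b)
  have hU := stratumIsolated_of_iso hg hiso
  exact (locTower_C_eq_empty_iff hc hRa hν h0 hX hreach b hU n).mpr
    ((invariant_strongPlus hc hRf hRa hν h0 hX hreach b hb hiso M hBirth n hn).1.2.1 hw)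

end Summit.ResolutionOfSingularities.ResolutionOfSingularities.Theorems.SigmaMaxModificationsCorridor3.Moving.Seg

end
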